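import Summits.QuantumAdvantage.QuantumAdvantage.Theorems.CubicForrelationNearExactIsExactTwelveBoundary
import Summits.QuantumAdvantage.QuantumAdvantage.Theorems.CubicForrelationNearExactIsExactSecondWeight

/-!
# Crux `CubicForrelation.NearExactIsExact` (stmt-QuantumAdvantage-14043) — n = 12 window, type O: tools for the RELATIVE 2-adic tower
  (base pattern `τ₀`, excess of a wild point, affine characters over traces of flats, cube congruences of the wild function, one tower level)

Certificate seat `b2b-cforr-cert` (gen 12).  HONEST FRAMING: lemmas (standard axioms) feeding the theorem `to12_typeO_le` of
`…TwelveTypeOWindow.lean` (a type-O side forces `Φ ≤ 59/64` for cubic pairs on 12 bits); finite-slice bookkeeping, NOT summit progress.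

Setting (`W_g = 16u`, `u` odd = type O, `s = (−1)^f`, `τ = u − 4s`, digits `u ≡ 1 + 2d₁ + 4d₂ (mod 8)`, `d₁` affine, `d₂` cubic,
`E = {d₁ = d₂}` a 9-flat `x_E ⊕ V_E`):
* `to12_pt_mod8`: `τ ≡ τ₀ := (−1)^{d₁}(1 − 4·1_E) (mod 8)` pointwise, for either sign `s` — so `τ = τ₀ + 8v` with an integer WILD function `v`;
* `to12_excess`: `(τ₀ + 8v)² − τ₀² ≥ 16c(4c − 3)` whenever `|v| ≥ c ≥ 1` (`16, 160, 832, 3712` for `c = 1, 2, 4, 8`);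
* `to12_card_mul_le`: two xor-closed sets `A, B ⊆ 𝔽₂ⁿ` satisfy `#A·#B ≤ 2ⁿ·#(A ∩ B)`; `to12_char_sum`: a `±1` character sums to `#W` or `0`
  over an xor-closed `W`; `to12_flat_char_dvd`: hence an affine character summed over the trace `A ∩ (x₀ ⊕ B)` is divisible by `2^c` whenever
  `n + c ≤ log₂#A + log₂#B`;
* `to12_cube_congr`: on a coordinate cube `C_I` the wild function has `Σ_{C_I} v ≡ 0 (mod 2 / 4 / 8)` for `|I| ≥ 5 / 7 / 10` (Poisson + Ax for
  `u` via `cube_sum_dvd`, Ax for `(−1)^f` and `(−1)^{d₁}`, the flat lemma for `Σ_{C_I ∩ E}(−1)^{d₁} ∈ 2^{|I|−3}ℤ`);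
* `to12_level`: if `Σ_{C_I} v` is even for all `|I| > D` then `[v odd]` has degree `≤ D` (Möbius) and so `≥ 2^{12−D}` points, or `v` is even.

References: J. Ax (1964) / R. J. McEliece (1972); MacWilliams–Sloane (1977) Ch. 13; R. O'Donnell (2014) §3.3.  Everything below is proved from
Mathlib and the tree; axioms are the standard three.
-/

set_option linter.dupNamespace false -- D-0017: single-problem summit ⇒ `QuantumAdvantage.QuantumAdvantage` by design

noncomputable section

namespace Summit.QuantumAdvantage.QuantumAdvantage.Theorems.CubicForrelation.NearExactIsExact

open Finset
open Literature.Computability.QuantumComplexity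
open Literature.Computability.QuantumComplexity.BuzetChailloux (bxor zeroVec bxor_bxor_cancel_left bxor_zeroVec zeroVec_bxor bxor_comm
  bxor_self)
open Literature.Computability.QuantumComplexity.DerivativeWalsh (W)
open Summit.QuantumAdvantage.QuantumAdvantage.Theorems.NearExactIsExact.Negative (TypeOTwelve.no_caseA TypeOTwelve.cube_sum_dvd
  TypeOTwelve.typeO_of_exists_odd)

/-! ### Pointwise arithmetic: the base pattern `τ₀` and the excess of a wild point -/

/-- The two 2-adic digits `[⌊w/2⌋ odd]`, `[⌊w/4⌋ odd]` are `8`-periodic. [folklore] -/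
theorem to12_digit_shift (q r : ℤ) :
    (Odd ((8 * q + r) / 2) ↔ Odd (r / 2)) ∧ (Odd ((8 * q + r) / 2 / 2) ↔ Odd (r / 2 / 2)) := by
  have h1 : (8 * q + r) / 2 = r / 2 + 4 * q := by
    rw [show 8 * q + r = r + 2 * (4 * q) by ring, Int.add_mul_ediv_left _ _ (by norm_num)]
  have h2 : (r / 2 + 4 * q) / 2 = r / 2 / 2 + 2 * q := by
    rw [show r / 2 + 4 * q = r / 2 + 2 * (2 * q) by ring, Int.add_mul_ediv_left _ _ (by norm_num)]
  have e4 : Even (4 * q : ℤ) := ⟨2 * q, by ring⟩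
  have e2 : Even (2 * q : ℤ) := ⟨q, by ring⟩
  rw [h1, h2]
  exact ⟨by rw [Int.odd_add]; exact ⟨fun h => h.2 e4, fun h => ⟨fun _ => e4, fun _ => h⟩⟩,
    by rw [Int.odd_add]; exact ⟨fun h => h.2 e2, fun h => ⟨fun _ => e2, fun _ => h⟩⟩⟩

/-- **The base pattern.** For odd `w` and `s = ±1`: `w − 4s ≡ τ₀ (mod 8)` with `τ₀ = (−1)^{d₁}(1 − 4·[d₁ = d₂])`, `d₁ = [⌊w/2⌋ odd]`,
`d₂ = [⌊w/4⌋ odd]` — independently of `s`. [this work] -/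
theorem to12_pt_mod8 (w s : ℤ) (hw : Odd w) (hs : s = 1 ∨ s = -1) :
    ∃ v : ℤ, w - 4 * s =
      sZ (decide (Odd (w / 2))) * (1 - 4 * (if (Odd (w / 2) ↔ Odd (w / 2 / 2)) then 1 else 0)) + 8 * v := by
  obtain ⟨q, r, hr0, hr8, rfl⟩ : ∃ q r : ℤ, 0 ≤ r ∧ r < 8 ∧ w = 8 * q + r :=
    ⟨w / 8, w % 8, by omega, by omega, by omega⟩
  obtain ⟨hd1, hd2⟩ := to12_digit_shift q r
  simp only [hd1, hd2]
  rw [Int.odd_iff] at hw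
  rcases hs with rfl | rfl
  · refine ⟨q, ?_⟩
    interval_cases r <;> norm_num [sZ, Int.odd_iff] <;> omega
  · refine ⟨q + 1, ?_⟩
    interval_cases r <;> norm_num [sZ, Int.odd_iff] <;> omega

/-- **Excess of a wild point.** For `t ∈ {±1, ±3}`, `1 ≤ c` and `|v| ≥ c`: `(t + 8v)² − t² ≥ 16c(4c − 3)`
(`= 16, 160, 832, 3712` for `c = 1, 2, 4, 8`). [this work] -/
theorem to12_excess (t v c : ℤ) (ht : t = 1 ∨ t = -1 ∨ t = 3 ∨ t = -3) (hc : 1 ≤ c) (hv : c ≤ v ∨ v ≤ -c) :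
    16 * c * (4 * c - 3) ≤ (t + 8 * v) ^ 2 - t ^ 2 := by
  have ht3 : -3 ≤ t ∧ t ≤ 3 := by rcases ht with rfl | rfl | rfl | rfl <;> norm_num
  rcases hv with hv | hv
  · nlinarith [mul_nonneg (sub_nonneg.2 hv) (show (0:ℤ) ≤ 64 * (v + c) - 48 by linarith),
      mul_nonneg (show (0:ℤ) ≤ v by linarith) (show (0:ℤ) ≤ t + 3 by linarith)]
  · nlinarith [mul_nonneg (show (0:ℤ) ≤ -v - c by linarith) (show (0:ℤ) ≤ 64 * (-v + c) - 48 by linarith),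
      mul_nonneg (show (0:ℤ) ≤ -v by linarith) (show (0:ℤ) ≤ 3 - t by linarith)]

/-- The excess is never negative. [this work] -/
theorem to12_excess_nonneg (t v : ℤ) (ht : t = 1 ∨ t = -1 ∨ t = 3 ∨ t = -3) : 0 ≤ (t + 8 * v) ^ 2 - t ^ 2 := by
  rcases eq_or_ne v 0 with rfl | hv
  · simp
  · have h := to12_excess t v 1 ht le_rfl (by omega)
    linarith

/-! ### Xor-closed sets: cubes, intersections, cosets, character sums -/

section XorClosed

variable {n : ℕ}

/-- Coordinate cubes are xor-closed and contain `0ⁿ`. [folklore] -/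
theorem to12_cube_xorClosed (I : Finset (Fin n)) :
    zeroVec ∈ ({x : Fin n → Bool | ∀ i, x i = true → i ∈ I} : Finset _) ∧
      ∀ x ∈ ({x : Fin n → Bool | ∀ i, x i = true → i ∈ I} : Finset _),
        ∀ y ∈ ({x : Fin n → Bool | ∀ i, x i = true → i ∈ I} : Finset _),
          bxor x y ∈ ({x : Fin n → Bool | ∀ i, x i = true → i ∈ I} : Finset _) := by
  refine ⟨mem_filter.2 ⟨mem_univ _, fun i hi => by simp [zeroVec] at hi⟩, fun x hx y hy => mem_filter.2 ⟨mem_univ _, fun i hi => ?_⟩⟩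
  have hx' := (mem_filter.1 hx).2 i
  have hy' := (mem_filter.1 hy).2 i
  simp only [bxor] at hi
  revert hi hx' hy'
  cases x i <;> cases y i <;> simp

/-- Xor bookkeeping: `a ⊕ b = a' ⊕ b' ⇒ a ⊕ a' = b ⊕ b'`. [folklore] -/
theorem to12_bxor_swap {a b a' b' : Fin n → Bool} (h : bxor a b = bxor a' b') : bxor a a' = bxor b b' := by
  funext i
  have hi := congrFun h i
  simp only [bxor] at hi ⊢
  revert hi
  cases a i <;> cases b i <;> cases a' i <;> cases b' i <;> decide

/-- **Two xor-closed sets meet in at least `#A·#B/2ⁿ` points**: `#A·#B ≤ 2ⁿ·#(A ∩ B)` (the fibres of `(a,b) ↦ a ⊕ b` embed into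
`A ∩ B`). [folklore] -/
theorem to12_card_mul_le (A B : Finset (Fin n → Bool)) (hA : ∀ x ∈ A, ∀ y ∈ A, bxor x y ∈ A)
    (hB : ∀ x ∈ B, ∀ y ∈ B, bxor x y ∈ B) : #A * #B ≤ 2 ^ n * #(A ∩ B) := by
  classical
  have h1 : #(A ×ˢ B) ≤ #(A ∩ B) * #((A ×ˢ B).image fun p => bxor p.1 p.2) := by
    refine card_le_mul_card_image _ _ fun z hz => ?_
    obtain ⟨p₀, hp₀, rfl⟩ := mem_image.1 hz
    have hp₀A : p₀.1 ∈ A := (mem_product.1 hp₀).1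
    have hp₀B : p₀.2 ∈ B := (mem_product.1 hp₀).2
    refine card_le_card_of_injOn (fun p => bxor p.1 p₀.1) (fun p hp => ?_) (fun p hp p' hp' heq => ?_)
    · have hp1 := (mem_filter.1 hp)
      have hpA : p.1 ∈ A := (mem_product.1 hp1.1).1
      have hpB : p.2 ∈ B := (mem_product.1 hp1.1).2
      show bxor p.1 p₀.1 ∈ ((A ∩ B : Finset (Fin n → Bool)) : Set (Fin n → Bool))
      rw [mem_coe, mem_inter]
      refine ⟨hA _ hpA _ hp₀A, ?_⟩
      rw [to12_bxor_swap hp1.2]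
      exact hB _ hpB _ hp₀B
    · have hp1 := (mem_filter.1 (mem_coe.1 hp))
      have hp1' := (mem_filter.1 (mem_coe.1 hp'))
      have hfst : p.1 = p'.1 := by
        have := congrArg (fun x => bxor x p₀.1) heq
        simpa [iw_bxor_assoc] using this
      refine Prod.ext hfst ?_
      have h2 := hp1.2.trans hp1'.2.symm
      rw [hfst] at h2
      simpa using congrArg (bxor p'.1) h2
  have h2 : #((A ×ˢ B).image fun p => bxor p.1 p.2) ≤ 2 ^ n := by
    calc #((A ×ˢ B).image fun p => bxor p.1 p.2) ≤ #(univ : Finset (Fin n → Bool)) := card_le_univ _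
      _ = 2 ^ n := by rw [card_univ, Fintype.card_fun, Fintype.card_bool, Fintype.card_fin]
  rw [card_product] at h1
  calc #A * #B ≤ #(A ∩ B) * #((A ×ˢ B).image fun p => bxor p.1 p.2) := h1
    _ ≤ #(A ∩ B) * 2 ^ n := Nat.mul_le_mul_left _ h2
    _ = 2 ^ n * #(A ∩ B) := mul_comm _ _

/-- **A `±1` character sums to `#W` or `0` over an xor-closed `W`.** [folklore] -/
theorem to12_char_sum (W : Finset (Fin n → Bool)) (hW : ∀ x ∈ W, ∀ y ∈ W, bxor x y ∈ W) (χ : (Fin n → Bool) → ℤ)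
    (h1 : ∀ w, χ w = 1 ∨ χ w = -1) (hmul : ∀ a b, χ (bxor a b) = χ a * χ b) :
    ∑ w ∈ W, χ w = #W ∨ ∑ w ∈ W, χ w = 0 := by
  by_cases hall : ∀ w ∈ W, χ w = 1
  · left
    rw [sum_congr rfl hall, sum_const, nsmul_eq_mul, mul_one]
  · right
    push Not at hall
    obtain ⟨w₀, hw₀, hχ⟩ := hall
    have hχ' : χ w₀ = -1 := (h1 w₀).resolve_left hχ
    have key : ∑ w ∈ W, χ w = ∑ w ∈ W, χ (bxor w w₀) :=
      (sum_nbij' (fun w => bxor w w₀) (fun w => bxor w w₀) (fun w hw => hW _ hw _ hw₀) (fun w hw => hW _ hw _ hw₀)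
        (fun w _ => by rw [iw_bxor_assoc, bxor_self, bxor_zeroVec]) (fun w _ => by rw [iw_bxor_assoc, bxor_self, bxor_zeroVec])
        (fun w _ => rfl)).symm
    rw [sum_congr rfl fun w _ => hmul w w₀, ← sum_mul, hχ'] at key
    linarith

/-- **An affine character over the trace of a flat on an xor-closed set.** Let `A ∋ 0` be xor-closed with `#A = 2^a`, `B ∋ 0` xor-closed
with `#B = 2^b`, `E = x₀ ⊕ B` a coset, `ℓ` affine (degree `≤ 1`) and `n + c ≤ a + b`.  Then `2^c ∣ Σ_{x ∈ A ∩ E} (−1)^{ℓ(x)}`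
(`A ∩ E` is empty or a coset of `A ∩ B`, an xor-closed set of `2^j ≥ 2^c` elements, on which `(−1)^{ℓ + ℓ(0)}` is a character).
[this work] -/
theorem to12_flat_char_dvd (A B : Finset (Fin n → Bool)) (x₀ : Fin n → Bool) (hA0 : zeroVec ∈ A)
    (hA : ∀ x ∈ A, ∀ y ∈ A, bxor x y ∈ A) (hB0 : zeroVec ∈ B) (hB : ∀ x ∈ B, ∀ y ∈ B, bxor x y ∈ B)
    (ℓ : (Fin n → Bool) → Bool) (hℓ : IsDegLeFun 1 ℓ) {a b c : ℕ} (haA : #A = 2 ^ a) (hbB : #B = 2 ^ b) (habc : n + c ≤ a + b) :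
    (2 : ℤ) ^ c ∣ ∑ x ∈ A, (if x ∈ B.image (bxor x₀) then sZ (ℓ x) else 0) := by
  classical
  -- the xor-closed set `W = A ∩ B` and its size
  have hW0 : zeroVec ∈ A ∩ B := mem_inter.2 ⟨hA0, hB0⟩
  have hWadd : ∀ x ∈ A ∩ B, ∀ y ∈ A ∩ B, bxor x y ∈ A ∩ B := fun x hx y hy =>
    mem_inter.2 ⟨hA _ (mem_inter.1 hx).1 _ (mem_inter.1 hy).1, hB _ (mem_inter.1 hx).2 _ (mem_inter.1 hy).2⟩
  obtain ⟨j, -, hj⟩ := sw_card_xorClosed (A ∩ B) hW0 hWadd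
  have hcj : c ≤ j := by
    have h := to12_card_mul_le A B hA hB
    rw [haA, hbB, hj, ← pow_add, ← pow_add] at h
    have := (Nat.pow_le_pow_iff_right (by norm_num : 1 < 2)).1 h
    omega
  have hdvdW : (2 : ℤ) ^ c ∣ (#(A ∩ B) : ℤ) := by
    rw [hj]; push_cast; exact pow_dvd_pow 2 hcj
  rw [← sum_filter]
  by_cases hne : (A.filter fun x => x ∈ B.image (bxor x₀)).Nonempty
  · obtain ⟨y₀, hy₀⟩ := hne
    have hy₀A : y₀ ∈ A := (mem_filter.1 hy₀).1
    have hy₀E : y₀ ∈ B.image (bxor x₀) := (mem_filter.1 hy₀).2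
    -- reindex the trace `A ∩ E` by `W` via `x ↦ y₀ ⊕ x`
    have hreindex : ∑ x ∈ A.filter (fun x => x ∈ B.image (bxor x₀)), sZ (ℓ x) = ∑ w ∈ A ∩ B, sZ (ℓ (bxor y₀ w)) := by
      refine sum_nbij' (fun x => bxor y₀ x) (fun w => bxor y₀ w) (fun x hx => ?_) (fun w hw => ?_)
        (fun x _ => bxor_bxor_cancel_left y₀ x) (fun w _ => bxor_bxor_cancel_left y₀ w)
        (fun x _ => by rw [bxor_bxor_cancel_left])
      · have hxA : x ∈ A := (mem_filter.1 hx).1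
        have hxE : x ∈ B.image (bxor x₀) := (mem_filter.1 hx).2
        refine mem_inter.2 ⟨hA _ hy₀A _ hxA, ?_⟩
        have h1 : bxor x₀ y₀ ∈ B := fl1_coset_diff rfl hy₀E
        have h2 : bxor x₀ x ∈ B := fl1_coset_diff rfl hxE
        have h3 := hB _ h1 _ h2
        rwa [bxor_comm x₀ y₀, iw_bxor_assoc, bxor_bxor_cancel_left] at h3
      · exact mem_filter.2 ⟨hA _ hy₀A _ (mem_inter.1 hw).1, fl1_coset_vadd hB rfl hy₀E (mem_inter.1 hw).2⟩
    rw [hreindex]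
    -- affinity: `ℓ(y₀ ⊕ w) = ℓ y₀ ⊕ ℓ 0 ⊕ ℓ w`
    have haff : ∀ w, sZ (ℓ (bxor y₀ w)) = sZ (ℓ y₀) * sZ (ℓ zeroVec ^^ ℓ w) := by
      intro w
      rw [ar_affine_apply_bxor stub_derivDegree hℓ y₀ w]
      cases ℓ y₀ <;> cases ℓ zeroVec <;> cases ℓ w <;> simp [sZ]
    rw [sum_congr rfl fun w _ => haff w, ← mul_sum]
    have hχ := to12_char_sum (A ∩ B) hWadd (fun w => sZ (ℓ zeroVec ^^ ℓ w))
      (fun w => by cases (ℓ zeroVec ^^ ℓ w) <;> simp [sZ])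
      (fun u v => by
        rw [ar_affine_apply_bxor stub_derivDegree hℓ u v]
        cases ℓ u <;> cases ℓ zeroVec <;> cases ℓ v <;> simp [sZ])
    rcases hχ with h | h
    · rw [h]; exact Dvd.dvd.mul_left hdvdW _
    · rw [h, mul_zero]; exact dvd_zero _
  · rw [not_nonempty_iff_eq_empty.1 hne, sum_empty]; exact dvd_zero _

end XorClosed

/-! ### The cube congruences of the wild function -/

/-- **Cube congruences.**  For cubic `f, g` on 12 bits with `W_g = 16u`, affine first digit `d₁ = [⌊u/2⌋ odd]`, a 9-flat `E = x_E ⊕ V_E`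
and an integer function `v` with `u − 4(−1)^f = (−1)^{d₁}(1 − 4·1_E) + 8v` pointwise: on every coordinate cube `C_I`, `Σ_{C_I} v` is even
if `|I| ≥ 5`, divisible by `4` if `|I| ≥ 7`, and by `8` if `|I| ≥ 10` (Poisson + Ax for `u`, Ax for `(−1)^f` and `(−1)^{d₁}`, and
`to12_flat_char_dvd` for the trace of `E`). [this work] -/
theorem to12_cube_congr (f g : (Fin (6 + 6) → Bool) → Bool) (hf : IsDegLeFun 3 f) (hg : IsDegLeFun 3 g)
    (u : (Fin (6 + 6) → Bool) → ℤ) (hu : ∀ x, W (fun y => signOf (g y)) x = (2 : ℝ) ^ 4 * (u x : ℝ))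
    (hd1 : IsDegLeFun 1 (fun x => decide (Odd (u x / 2))))
    (VE : Finset (Fin (6 + 6) → Bool)) (xE : Fin (6 + 6) → Bool) (hVE0 : zeroVec ∈ VE)
    (hVEadd : ∀ a ∈ VE, ∀ b ∈ VE, bxor a b ∈ VE) (hcardVE : #VE = 512)
    (v : (Fin (6 + 6) → Bool) → ℤ)
    (hv : ∀ x, u x - 4 * sZ (f x) =
      sZ (decide (Odd (u x / 2))) * (1 - 4 * (if x ∈ VE.image (bxor xE) then 1 else 0)) + 8 * v x)
    (I : Finset (Fin (6 + 6))) :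
    (5 ≤ #I → (2 : ℤ) ∣ ∑ x ∈ {x : Fin (6 + 6) → Bool | ∀ i, x i = true → i ∈ I}, v x) ∧
    (7 ≤ #I → (4 : ℤ) ∣ ∑ x ∈ {x : Fin (6 + 6) → Bool | ∀ i, x i = true → i ∈ I}, v x) ∧
    (10 ≤ #I → (8 : ℤ) ∣ ∑ x ∈ {x : Fin (6 + 6) → Bool | ∀ i, x i = true → i ∈ I}, v x) := by
  classical
  have hk : #I ≤ 6 + 6 := (card_le_univ I).trans_eq (Fintype.card_fin _)
  have hVE9 : #VE = 2 ^ 9 := by rw [hcardVE]; norm_num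
  obtain ⟨hC0, hCadd⟩ := to12_cube_xorClosed I
  have hcardC := bb_card_cube I
  -- Ax for `(−1)^f`
  obtain ⟨zs, hzs⟩ := stub_axParity (6 + 6) 3 f I (by norm_num) hf
  have hs : (∑ x ∈ {x : Fin (6 + 6) → Bool | ∀ i, x i = true → i ∈ I}, sZ (f x) : ℤ) = 2 ^ ((#I + 2) / 3) * zs := by
    have h : ((∑ x ∈ {x : Fin (6 + 6) → Bool | ∀ i, x i = true → i ∈ I}, sZ (f x) : ℤ) : ℝ) = (2 : ℝ) ^ ((#I + 3 - 1) / 3) * zs := by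
      push_cast; simp_rw [tp_sZ_cast]; exact hzs
    rw [show (#I + 3 - 1) / 3 = (#I + 2) / 3 by omega] at h
    exact_mod_cast h
  -- Ax for the affine digit
  obtain ⟨z1, hz1⟩ := stub_axParity (6 + 6) 1 (fun x => decide (Odd (u x / 2))) I le_rfl hd1
  have hdig : (∑ x ∈ {x : Fin (6 + 6) → Bool | ∀ i, x i = true → i ∈ I}, sZ (decide (Odd (u x / 2))) : ℤ) = 2 ^ #I * z1 := by
    have h : ((∑ x ∈ {x : Fin (6 + 6) → Bool | ∀ i, x i = true → i ∈ I}, sZ (decide (Odd (u x / 2))) : ℤ) : ℝ) =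
        (2 : ℝ) ^ ((#I + 1 - 1) / 1) * z1 := by
      push_cast; simp_rw [tp_sZ_cast]; exact hz1
    rw [show (#I + 1 - 1) / 1 = #I by omega] at h
    exact_mod_cast h
  -- the identity `8 Σ v = Σ u − 4 Σ s − Σ (−1)^{d₁} + 4 Σ_{E} (−1)^{d₁}`
  have hsum : 8 * ∑ x ∈ {x : Fin (6 + 6) → Bool | ∀ i, x i = true → i ∈ I}, v x =
      (∑ x ∈ {x : Fin (6 + 6) → Bool | ∀ i, x i = true → i ∈ I}, u x)
      - 4 * (∑ x ∈ {x : Fin (6 + 6) → Bool | ∀ i, x i = true → i ∈ I}, sZ (f x))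
      - (∑ x ∈ {x : Fin (6 + 6) → Bool | ∀ i, x i = true → i ∈ I}, sZ (decide (Odd (u x / 2))))
      + 4 * (∑ x ∈ {x : Fin (6 + 6) → Bool | ∀ i, x i = true → i ∈ I},
          (if x ∈ VE.image (bxor xE) then sZ (decide (Odd (u x / 2))) else 0)) := by
    rw [mul_sum, mul_sum, mul_sum, ← sum_sub_distrib, ← sum_sub_distrib, ← sum_add_distrib]
    refine sum_congr rfl fun x _ => ?_
    have h := hv x
    split_ifs at h ⊢ <;> linarith
  have hdv : ∀ {a e : ℕ} {X : ℤ}, (2 : ℤ) ^ a ∣ X → e ≤ a → (2 : ℤ) ^ e ∣ X := fun h he => (pow_dvd_pow 2 he).trans h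
  have key : ∀ r : ℕ, (2 : ℤ) ^ r ∣ (∑ x ∈ {x : Fin (6 + 6) → Bool | ∀ i, x i = true → i ∈ I}, u x) →
      r ≤ (#I + 2) / 3 + 2 → r ≤ #I → r ≤ #I - 3 + 2 → 3 ≤ #I →
      (2 : ℤ) ^ r ∣ 8 * ∑ x ∈ {x : Fin (6 + 6) → Bool | ∀ i, x i = true → i ∈ I}, v x := by
    intro r hU hr1 hr2 hr3 h3
    obtain ⟨wF, hwF⟩ := to12_flat_char_dvd _ VE xE hC0 hCadd hVE0 hVEadd _ hd1 (c := #I - 3) hcardC hVE9 (by omega)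
    have h2 : (2 : ℤ) ^ r ∣ 4 * (2 ^ ((#I + 2) / 3) * zs) := by
      rw [← mul_assoc, show (4 : ℤ) * 2 ^ ((#I + 2) / 3) = 2 ^ ((#I + 2) / 3 + 2) by ring]
      exact hdv (dvd_mul_right _ _) hr1
    have h3' : (2 : ℤ) ^ r ∣ 2 ^ #I * z1 := hdv (dvd_mul_right _ _) hr2
    have h4 : (2 : ℤ) ^ r ∣ 4 * (∑ x ∈ {x : Fin (6 + 6) → Bool | ∀ i, x i = true → i ∈ I},
        (if x ∈ VE.image (bxor xE) then sZ (decide (Odd (u x / 2))) else 0)) := by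
      rw [hwF, ← mul_assoc, show (4 : ℤ) * 2 ^ (#I - 3) = 2 ^ (#I - 3 + 2) by ring]
      exact hdv (dvd_mul_right _ _) hr3
    rw [hsum, hs, hdig]
    exact ((hU.sub h2).sub h3').add h4
  refine ⟨fun h5 => ?_, fun h7 => ?_, fun h10 => ?_⟩
  · have h := key 4 (TypeOTwelve.cube_sum_dvd g u hg hu I 4 (by omega)) (by omega) (by omega) (by omega) (by omega)
    norm_num at h
    omega
  · have h := key 5 (TypeOTwelve.cube_sum_dvd g u hg hu I 5 (by omega)) (by omega) (by omega) (by omega) (by omega)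
    norm_num at h
    omega
  · have h := key 6 (TypeOTwelve.cube_sum_dvd g u hg hu I 6 (by omega)) (by omega) (by omega) (by omega) (by omega)
    norm_num at h
    omega

/-! ### One level of the relative tower -/

/-- **A tower level.**  If `Σ_{C_I} v` is even on every coordinate cube with `|I| > D`, then either every `v(x)` is even or the odd set of
`v` (a Boolean function of degree `≤ D` by Möbius inversion) has at least `2^{12−D}` points (Reed–Muller). [this work] -/
theorem to12_level (v : (Fin (6 + 6) → Bool) → ℤ) (D : ℕ)
    (hcube : ∀ I : Finset (Fin (6 + 6)), D < #I → (2 : ℤ) ∣ ∑ x ∈ {x : Fin (6 + 6) → Bool | ∀ i, x i = true → i ∈ I}, v x) :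
    (∀ x, Even (v x)) ∨ 2 ^ (6 + 6) ≤ 2 ^ D * #(univ.filter fun x => Odd (v x)) := by
  classical
  have hdeg : IsDegLeFun D (fun x => decide (Odd (v x))) := by
    refine bb_moebius_isDegLeFun D _ fun I hI => ?_
    have hE : Even (∑ x ∈ {x : Fin (6 + 6) → Bool | ∀ i, x i = true → i ∈ I}, v x) := even_iff_two_dvd.2 (hcube I hI)
    have hE' := (tw_even_sum_iff _ v).1 hE
    rw [filter_filter] at hE'
    simpa only [decide_eq_true_eq] using hE'
  by_cases hex : ∃ x, Odd (v x)
  · right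
    obtain ⟨x, hx⟩ := hex
    have h := bb_rmWeight_holds (6 + 6) D _ hdeg ⟨x, decide_eq_true hx⟩
    have e : (univ.filter fun x => decide (Odd (v x)) = true) = univ.filter fun x => Odd (v x) :=
      filter_congr fun x _ => by simp
    rwa [e] at h
  · left
    push Not at hex
    exact fun x => Int.not_odd_iff_even.1 (hex x)

end Summit.QuantumAdvantage.QuantumAdvantage.Theorems.CubicForrelation.NearExactIsExact

end
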